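import Summits.QuantumFields.YangMills.Theorems.BalabanUVNodesPortS1JacobianHoloSL2
import Literature.MathematicalPhysics.QuantumFieldTheory.Balaban1983to89.B7Prop6Flat

/-!
# NODE O port PT-A — THE HOLOMORPHIC (0.4) MODEL IS GAUGE COVARIANT UNDER DETERMINANT-ONE (`SL(2,ℂ)`-VALUED) TRANSFORMATIONS `W ↦ (b ↦ u(b₋)·W(b)·adj u(b₊))`:
# `holMh` telescopes, loop matrices and the correction factor conjugate by `u(emb c₋)` (the series logarithm and the exponential are conjugation covariant for UNITS with no hypothesis), and
# `avgMh(W^u)(c) = u(emb c₋)·avgMh(W)(c)·adj u(emb c₊)` — the (0.6)∕(1.10) covariance that row (d) of `stub_LZjac` needs in the COMPLEX model (the `SU(2)` edition is the tree's `avgFun_covariant`)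

Cell `ym-nodeO-ideate`, porter seat `ymgap-nodeO-port-PTA-1` (gen 5); `--supports stmt-QuantumFields-27930` (helper; registered stub `stub_LZjac`, PORT-PLAN-v5 §4 row (d)).  [I] = [Balaban1987RG1], [B7] = [Balaban1985Averaging].
CONSUMED BY NAME: `B15AveragingHolomorphic` (`stepMh`, `holMh`, `loopMh`, `axialMh`, `corrMh`, `avgMh`), `T4Continuum` walk bookkeeping (`walk`, `walkEnd`, `walkEnd_eq_self_of_netDisp`, `netDisp_loopWord`,
`walkEnd_replicate_L` — the pattern of `holAt_gaugeAct_walk`), `B7Prop6Flat.mlog_conj`, Mathlib's `NormedSpace.exp_units_conj`, `Matrix.adjugate_mul_distrib ∕ adjugate_adjugate' ∕ adjugate_mul ∕ mul_adjugate`.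
* §1 `adjugate_mul_self_of_det_eq_one`, `self_mul_adjugate_of_det_eq_one`, `adjugate_adjugate_two`.
* §2 ★ `holMh_gauge_walk`, ★ `loopMh_gauge`, ★ `axialMh_gauge`, ★ `corrMh_gauge`, ★★ `avgMh_gauge`.

HONEST FRAMING.  Finite algebra over the tree's holomorphic model; NOTHING of Bałaban asserted; the derivative-level covariance (`jacBlockC c (W^u) = Ad^ℂ(u(c₋))·jacBlockC c W·Ad^ℂ(adj u(b₀(c)₋))`) is the
next file (gen 6: `avgMh ∘ T_u = Conj ∘ avgMh` with `T_u` linear ⇒ `fderiv` covariance; then ✓p812756's `su2CoordC_conj_eq_sum` + `trace_jacResponse_eq_zero` and ✓p812578's `det_adMatC`); `stub_LZjac` OPEN;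
`stub_LZdet` BLOCKED-ON P0 (α)+(β); `stub_FE` XXL; 27930 OPEN · no claim; K0⁷∕K-Ax OPEN; NODE O 0∕1; COUNT 8∕28 · K 1∕4 UNMOVED; finite `𝕋⁴_{L^K}` at fixed ε — NOT continuum ∕ OS ∕ Clay; **the
Yang–Mills mass gap is NOT proved by any of this.**  No `sorry`, no `def`, no `instance`, no `notation`; standard axioms.
-/

noncomputable section

open scoped BigOperators Matrix.Norms.L2Operator Topology

namespace Summit.QuantumFields.YangMills.Theorems.BalabanUVNodesPortS1

open Summit.QuantumFields.YangMills.Theorems.K0RecordFormatNames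
open Literature.MathematicalPhysics.QuantumFieldTheory.Balaban1983to89
open Literature.MathematicalPhysics.QuantumFieldTheory.Balaban1983to89.Node00
open Literature.MathematicalPhysics.QuantumFieldTheory.Balaban1983to89.T4Continuum (T4Family LStep walk walkEnd Letter)
open Literature.MathematicalPhysics.QuantumFieldTheory.Balaban1983to89.BlockAveraging (Idx)
open Literature.MathematicalPhysics.QuantumFieldTheory.Balaban1983to89.ExpMeanLog (eml eml_eq_exp)
open Literature.MathematicalPhysics.QuantumFieldTheory.Balaban1983to89.B15AveragingHolomorphic
open _root_.Matrix _root_.Filter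

variable {P : Params} {j : ℕ}

/-! ## §1  Determinant-one `2 × 2` matrices: `adj` is the inverse and an involution -/

/-- `adj u · u = 1` at determinant one. [folklore] -/
theorem adjugate_mul_self_of_det_eq_one {u : MatA 2} (hu : u.det = 1) : u.adjugate * u = 1 := by
  rw [Matrix.adjugate_mul, hu, one_smul]

/-- `u · adj u = 1` at determinant one. [folklore] -/
theorem self_mul_adjugate_of_det_eq_one {u : MatA 2} (hu : u.det = 1) : u * u.adjugate = 1 := by
  rw [Matrix.mul_adjugate, hu, one_smul]

/-- `adj (adj A) = A` for `2 × 2` matrices. [folklore] -/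
theorem adjugate_adjugate_two (A : MatA 2) : A.adjugate.adjugate = A := by
  rw [Matrix.adjugate_adjugate', Fintype.card_fin]
  simp

/-! ## §2  ★ Covariance of holomorphic walk products, loop matrices, correction factor and average -/

/-- ★ **HOLOMORPHIC WALK PRODUCTS ARE COVARIANT** under `W ↦ (b ↦ u(b₋)·W(b)·adj u(b₊))` for det-one `u`: `holMh(W^u)(walk x w) = u(x)·holMh(W)(walk x w)·adj u(end)` (telescoping; backward steps through
`adj(ABC) = adj C·adj B·adj A` and `adj adj = id`). [cite: Balaban1985Averaging, (8) p.18; Balaban1987RG1, (1.10) p.262] -/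
theorem holMh_gauge_walk (u : Site P j → MatA 2) (hu : ∀ x, (u x).det = 1) (W : PBond P j → MatA 2) :
    ∀ (x : Site P j) (w : List (Letter P.d)),
      holMh (fun b : PBond P j => u b.src * W b * (u b.tgt).adjugate) (walk x w) = u x * holMh W (walk x w) * (u (walkEnd x w)).adjugate
  | x, [] => by
    simp only [walk, walkEnd, holMh_nil, mul_one]
    exact (self_mul_adjugate_of_det_eq_one (hu x)).symm
  | x, (μ, true) :: w => by
    rw [walk, walkEnd, holMh_cons, holMh_cons, holMh_gauge_walk u hu W (x.shift μ) w]
    simp only [stepMh, if_true]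
    show u x * W ⟨x, μ⟩ * (u (x.shift μ)).adjugate * (u (x.shift μ) * holMh W (walk (x.shift μ) w) * (u (walkEnd (x.shift μ) w)).adjugate) = _
    calc u x * W ⟨x, μ⟩ * (u (x.shift μ)).adjugate * (u (x.shift μ) * holMh W (walk (x.shift μ) w) * (u (walkEnd (x.shift μ) w)).adjugate)
        = u x * W ⟨x, μ⟩ * ((u (x.shift μ)).adjugate * u (x.shift μ)) * holMh W (walk (x.shift μ) w) * (u (walkEnd (x.shift μ) w)).adjugate := by noncomm_ring
      _ = u x * (W ⟨x, μ⟩ * holMh W (walk (x.shift μ) w)) * (u (walkEnd (x.shift μ) w)).adjugate := by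
        rw [adjugate_mul_self_of_det_eq_one (hu _), mul_one]; noncomm_ring
  | x, (μ, false) :: w => by
    have hus : (x.unshift μ).shift μ = x := by
      funext ν
      by_cases h : ν = μ
      · subst h; simp
      · simp [Site.shift_apply, Site.unshift_apply, h]
    rw [walk, walkEnd, holMh_cons, holMh_cons, holMh_gauge_walk u hu W (x.unshift μ) w]
    simp only [stepMh, Bool.false_eq_true, if_false]
    have htgt : (⟨x.unshift μ, μ⟩ : PBond P j).tgt = x := hus
    show (u (x.unshift μ) * W ⟨x.unshift μ, μ⟩ * (u ((⟨x.unshift μ, μ⟩ : PBond P j).tgt)).adjugate).adjugate *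
        (u (x.unshift μ) * holMh W (walk (x.unshift μ) w) * (u (walkEnd (x.unshift μ) w)).adjugate) = _
    rw [htgt, Matrix.adjugate_mul_distrib, Matrix.adjugate_mul_distrib, adjugate_adjugate_two]
    calc u x * ((W ⟨x.unshift μ, μ⟩).adjugate * (u (x.unshift μ)).adjugate) * (u (x.unshift μ) * holMh W (walk (x.unshift μ) w) * (u (walkEnd (x.unshift μ) w)).adjugate)
        = u x * (W ⟨x.unshift μ, μ⟩).adjugate * ((u (x.unshift μ)).adjugate * u (x.unshift μ)) * holMh W (walk (x.unshift μ) w) * (u (walkEnd (x.unshift μ) w)).adjugate := by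
          noncomm_ring
      _ = u x * ((W ⟨x.unshift μ, μ⟩).adjugate * holMh W (walk (x.unshift μ) w)) * (u (walkEnd (x.unshift μ) w)).adjugate := by
        rw [adjugate_mul_self_of_det_eq_one (hu _), mul_one]; noncomm_ring

/-- ★ **The (0.4) loop matrices transform by conjugation with `u(emb c₋)`** (closed walks). [cite: Balaban1987RG1, (0.4) p.253, (0.6) p.253] -/
theorem loopMh_gauge (u : Site P j → MatA 2) (hu : ∀ x, (u x).det = 1) (W : PBond P j → MatA 2) (c : PBond P (j + 1)) (i : Idx P) :
    loopMh (fun b : PBond P j => u b.src * W b * (u b.tgt).adjugate) c i = u (emb c.src) * loopMh W c i * (u (emb c.src)).adjugate := by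
  unfold loopMh
  rw [holMh_gauge_walk u hu W, T4Continuum.walkEnd_eq_self_of_netDisp]
  intro ν
  rw [T4Continuum.netDisp_loopWord, Int.cast_zero]

/-- ★ **The straight-segment matrix transforms as `u(emb c₋)·(·)·adj u(emb c₊)`.** [cite: Balaban1987RG1, (0.4) p.253] -/
theorem axialMh_gauge (u : Site P j → MatA 2) (hu : ∀ x, (u x).det = 1) (W : PBond P j → MatA 2) (c : PBond P (j + 1)) :
    axialMh (fun b : PBond P j => u b.src * W b * (u b.tgt).adjugate) c = u (emb c.src) * axialMh W c * (u (emb c.tgt)).adjugate := by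
  unfold axialMh
  rw [holMh_gauge_walk u hu W, T4Continuum.walkEnd_replicate_L]
  rfl

/-- ★ **The correction factor transforms by conjugation with `u(emb c₋)`** — `eml` is conjugation covariant for UNITS with NO hypothesis (`B7Prop6Flat.mlog_conj` termwise, `exp_units_conj`).
[cite: Balaban1987RG1, (0.6) p.253; Balaban1985Averaging, (21)–(22) p.21, p.24] -/
theorem corrMh_gauge (u : Site P j → MatA 2) (hu : ∀ x, (u x).det = 1) (W : PBond P j → MatA 2) (c : PBond P (j + 1)) :
    corrMh (fun b : PBond P j => u b.src * W b * (u b.tgt).adjugate) c = u (emb c.src) * corrMh W c * (u (emb c.src)).adjugate := by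
  letI : NormedAlgebra ℚ (MatA 2) := NormedAlgebra.restrictScalars ℚ ℂ (MatA 2)
  set g : MatA 2 := u (emb c.src) with hg
  let gu : (MatA 2)ˣ := { val := g, inv := g.adjugate, val_inv := self_mul_adjugate_of_det_eq_one (hu _), inv_val := adjugate_mul_self_of_det_eq_one (hu _) }
  have hfam : (fun i : Idx P => loopMh (fun b : PBond P j => u b.src * W b * (u b.tgt).adjugate) c i) = fun i => g * loopMh W c i * g.adjugate :=
    funext fun i => loopMh_gauge u hu W c i
  show eml (fun i : Idx P => loopMh (fun b : PBond P j => u b.src * W b * (u b.tgt).adjugate) c i) = g * eml (fun i : Idx P => loopMh W c i) * g.adjugate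
  rw [hfam, eml_eq_exp, eml_eq_exp]
  have hlog : ∀ i : Idx P, MatrixLog.mlog (g * loopMh W c i * g.adjugate) = g * MatrixLog.mlog (loopMh W c i) * g.adjugate :=
    fun i => B7Prop6Flat.mlog_conj gu (loopMh W c i)
  simp_rw [hlog]
  have hsum : ∑ x : Idx P, g * MatrixLog.mlog (loopMh W c x) * g.adjugate = g * (∑ i : Idx P, MatrixLog.mlog (loopMh W c i)) * g.adjugate := by
    rw [Finset.mul_sum, Finset.sum_mul]
  have hsm : ((Fintype.card (Idx P) : ℂ))⁻¹ • (g * (∑ i : Idx P, MatrixLog.mlog (loopMh W c i)) * g.adjugate) =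
      g * (((Fintype.card (Idx P) : ℂ))⁻¹ • ∑ i : Idx P, MatrixLog.mlog (loopMh W c i)) * g.adjugate := by
    rw [Matrix.mul_smul, Matrix.smul_mul]
  rw [hsum, hsm]
  exact NormedSpace.exp_units_conj gu _

/-- ★★ **THE HOLOMORPHIC (0.4) AVERAGE IS GAUGE COVARIANT under det-one transformations**: `avgMh(W^u)(c) = u(emb c₋)·avgMh(W)(c)·adj u(emb c₊)`. [cite: Balaban1987RG1, (0.4)–(0.6) p.253, (1.10) p.262] -/
theorem avgMh_gauge (u : Site P j → MatA 2) (hu : ∀ x, (u x).det = 1) (W : PBond P j → MatA 2) (c : PBond P (j + 1)) :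
    avgMh (fun b : PBond P j => u b.src * W b * (u b.tgt).adjugate) c = u (emb c.src) * avgMh W c * (u (emb c.tgt)).adjugate := by
  show corrMh _ c * axialMh _ c = u (emb c.src) * (corrMh W c * axialMh W c) * (u (emb c.tgt)).adjugate
  rw [corrMh_gauge u hu W c, axialMh_gauge u hu W c]
  calc u (emb c.src) * corrMh W c * (u (emb c.src)).adjugate * (u (emb c.src) * axialMh W c * (u (emb c.tgt)).adjugate)
      = u (emb c.src) * corrMh W c * ((u (emb c.src)).adjugate * u (emb c.src)) * axialMh W c * (u (emb c.tgt)).adjugate := by noncomm_ring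
    _ = u (emb c.src) * (corrMh W c * axialMh W c) * (u (emb c.tgt)).adjugate := by rw [adjugate_mul_self_of_det_eq_one (hu _), mul_one]; noncomm_ring

end Summit.QuantumFields.YangMills.Theorems.BalabanUVNodesPortS1

end
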